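import Summits.Ventures.PackingBounds.ThreePointCert.K16d14AggG1
import Summits.Ventures.PackingBounds.ThreePointCert.K16d14AggG2
import Summits.Ventures.PackingBounds.ThreePointCert.K16d14AggG3
import Summits.Ventures.PackingBounds.ThreePointCert.K16d14AggP
import Summits.Ventures.PackingBounds.ThreePointCert.CheckKSP

/-!
# κ(16) ≤ 7355: kernel validation (Kronecker substitution) of Gram blocks/parts R1.sym.g4, R1.anti.g1 (23913 factor entries; part 5 of 9)

Framing: lottery ticket; floor = certified bounds/negative ranges. Venture `PackingBounds` (cell
`pub-packcert`), three-point SDP family, kissing column. Integer data / kernel checks of a feasible point of the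
Bachoc–Vallentin semidefinite program (n = 16, s = 1/2, three-point matrix degree 14, two-point (Gegenbauer) part to
degree L = 28, Bachoc–Vallentin multiplier set = cell mode sym2; exact rational certificate `sdp-n16-d14-s1-2-sym2-a28-hyb8dd-j155378.json`
(sha256 5236165e8337efa2b46e04d3f9ecc3b9fc90f359d2fb3ed49ac145babc6ff505) of the sdp seat's hybrid pipeline, verified by the cell's two exact verifiers), converted by
`cert2lean_g9.py` (lp gen 9; S = 78) into the units of the kernel checker `ThreePointCert.Check` + `CheckSym2` with the
record degree field set to L = 28 (the checker's degree enters only the unit `W = 2^d·d!` and the side conditions, so a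
(d, L) certificate is a `Cert3` of degree L); symmetry-adapted PARTS (S₃/S₂ isotypic bases of short polynomials) with coarse factor COLUMNS, validated by
Kronecker substitution `ThreePointCert.CheckKSP` (`sosCheckKSParts`: the claimed expansion and `Σ_parts Σ_k col_k²` compared at `(2^w, 2^{wD}, 2^{wD²})`); three-point part by `CheckFKS`;
split check of (ii') `ThreePointCert.CheckSym2Split`. Emitter `emitlean_ks3.py` (lp gen 10; expansions `4^k • Σ_parts pᵀ(L′L′ᵀ)p` lifted by `SoundNN.boxNonneg_smul`). Generated file: plain lists of integers / monomials.
-/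

namespace Summit.Ventures.PackingBounds.ThreePointCert.K16d14

open Literature.Geometry.DiscreteGeometry Literature.Geometry.DiscreteGeometry.PolyCert PolyCert.SPoly

set_option maxRecDepth 100000 in
set_option maxHeartbeats 0 in
/-- Block `R1`, part `sym`, column group 4 (columns 154–307, 11935 factor entries): its expansion IS `Σ_(k in group) col_k²` — Kronecker-substitution check at `(2^201, 2^(201·27), …)`. -/
theorem vR1psymg4 : sosCheckKSParts 201 27 1 [K16d14.partR1symg4] K16d14.eR1psymg4 = true := by
  decide +kernel

set_option maxRecDepth 100000 in
set_option maxHeartbeats 0 in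
/-- Block `R1`, part `anti`, column group 1 (columns 0–52, 11978 factor entries): its expansion IS `Σ_(k in group) col_k²` — Kronecker-substitution check at `(2^198, 2^(198·27), …)`. -/
theorem vR1pantig1 : sosCheckKSParts 198 27 1 [K16d14.partR1antig1] K16d14.eR1pantig1 = true := by
  decide +kernel

end Summit.Ventures.PackingBounds.ThreePointCert.K16d14
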